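import Summits.ResolutionOfSingularities.ResolutionOfSingularities.Theses.Descent
import Literature.AlgebraicGeometry.Resolution.ValuedFunctionFields
import Literature.AlgebraicGeometry.Resolution.LocalUniformization
import Literature.AlgebraicGeometry.Resolution.ResolutionLU

/-!
# Sketch — crux `DescentPerfectToAll` (stmt-ResolutionOfSingularities-0549), crux idea `constant-swap`
# (planner res-B-lens-3 g5, lens «Picover / p-alteration», 2026-08-28).  Typed vocabulary + two kernel-checked
# assemblies; NOT a registered skeleton; counted 0; nothing here proves resolution of singularities in characteristic `p`.

## The lever (CONSTANT SWAP = a coefficient field chosen INSIDE `K`)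
Rung 1 of the line `valuative-constant-step` (`DiscreteInseparableResidueLU p`, copied verbatim below) asks for relative
local uniformization of a finitely generated `K/k` at a DISCRETE rank-one valuation ring `O ∋ k` whose residue field `κ`
is purely inseparable (algebraic) over `k̄` and `≠ k̄`.  The inseparability of `κ/k̄` is an artefact of insisting that the
radicands `c ∈ k` (`t̄₀^{p^n} = c̄`) are CONSTANTS.  If `k = k₁(c)` with `c` transcendental over a subfield `k₁`
(a FREE constant), then for ANY lift `t₀ ∈ O` of `t̄₀` the subfield `E := k₁(t₀) ⊆ K` is trivially valued, maps
isomorphically onto `κ = k̄₁(t̄₀)`, and `K = E(c, generators)` is again a function field — over the NEW constant field `E`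
the valuation is residually RATIONAL and still discrete, `c = t₀^{p^n} + (x-adic corrections)` having become a function.
Then `K` lies in the completion of the Abhyankar subfunction field `E(x)` (`x` a uniformizer), so Knaf–Kuhlmann 2009,
Thm. 1.5 (first bullet: smooth `E`-uniformization WITHOUT extending `F`) applies, and an `E`-model smooth at the centre is
turned into a `k`-model with the SAME local ring at the centre (localization transfer: non-zero elements of `k₁[t₀]` and
of `k₁[c]` are units at the centre).  No derivations, no purely inseparable descent, no type-D/E/F case distinction, any
exponent `n`, any number of extra residue generators as long as the residue field is rational over `k̄₁`.

## Items (sizes are guesses)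
* FACT  `KnafKuhlmann2009_Thm15` — KK 2009 (Adv. Math.; arXiv:math/0702856) Thm. 1.5, bullet `P|_K = id`, typed in the
  tree's ambient framework (`ValuedFunctionFields.lean`), conclusion weakened from "strongly smoothly" to "smoothly".  (S, vendor)
* STUB T1 `CoefficientFieldTransfer` (M) — smooth `E`-uniformization of `K` for every finite `Z` ⇒ `RelLocalUniformization k K O`.
* STUB T2 `SwapDensity` (M) — discrete `O`, `E ⊆ O` onto the residue field, `K/E` f.g. ⇒ `F₀ = E(x)` meets KK 1.5's hypotheses.
* STUB T3 `FreeRadicandLift p` (M, Mathlib field theory) — simple residue field + free radicand ⇒ the inner coefficient field exists.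
* SUB-RUNGS `CoefficientFieldSwapLU p` (rung 1 + the inner-coefficient-field hypothesis) and `FreeRadicandSimpleResidueLU p`
  (rung 1 + simple residue field of ANY exponent with a free radicand; no type-D/E/F clause); both are literal special cases
  of rung 1 (`sub_rung_swap`, `sub_rung_free`) and both are ASSEMBLED from the items (`…_of`, no `sorry`).

## Scope boundary (recorded in the card / NOTES, not typed here)
(i) For an ENTANGLED radicand (`c` algebraic over every subfield `k₁` with `k/k₁` finitely generated — this happens exactly on
the ground fields of the live regime, `k` not separably generated over a perfect subfield) NO inner coefficient field exists;
those cases stay with the arc-slice lever (type D) / the `∂/∂π` free slice (type E) / open (type-F chains).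
(ii) Infinite `κ/k̄` (possible on `k(x,y)` by Kuhlmann 2004, Thm. 1.1) is outside: an inner coefficient field forces `κ`
finitely generated over `k̄₁`.  (iii) The family `e(K) = ∞` (value group of `K·k^{perf}` not discrete) exists and lies in (ii).
-/

noncomputable section

set_option linter.dupNamespace false

open Literature.AlgebraicGeometry.Resolution

namespace Summit.ResolutionOfSingularities.ResolutionOfSingularities.Cruxes.DescentPerfectToAll.ConstantSwap

/-- VERBATIM COPY of the line's first rung `ValuativeConstantStep.DiscreteInseparableResidueLU`
(`Lines/valuative_constant_step.lean`, commit ba2af02981bf; also copied in `Lines/arc_slice_descent_sketch.lean`) — those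
modules are unbuilt on the farm, so the rung is restated instead of imported. -/
def DiscreteInseparableResidueLU (p : ℕ) : Prop :=
  ∀ (k K : Type) [Field k] [CharP k p] [Field K] [Algebra k K], (⊤ : IntermediateField k K).FG →
    ∀ O : ValuationSubring K, (∀ c : k, algebraMap k K c ∈ O) → IsDiscreteValuationRing O →
      (∀ t : K, t ∈ O → ∃ (c : k) (n : ℕ), O.valuation (t ^ p ^ n - algebraMap k K c) < 1) →
      (∃ t : K, t ∈ O ∧ ∀ c : k, 1 ≤ O.valuation (t - algebraMap k K c)) →
        RelLocalUniformization k K O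

/-- THE NEW HYPOTHESIS — an INNER COEFFICIENT FIELD of finite shape: a subfield `E ⊆ O` of `K` itself (hence trivially
valued) whose residues exhaust the residue field of `O` (so `E ≅ κ` and `K ⊆ E((x))`), generated by the image of a subfield
`k₁ ⊆ k` of finite co-type (`k/k₁` finitely generated) together with finitely many elements of `K`. -/
def HasInnerCoefficientField (k K : Type) [Field k] [Field K] [Algebra k K] (O : ValuationSubring K) : Prop :=
  ∃ (E : Subfield K) (k₁ : Subfield k) (S : Finset K),
    (E : Set K) ⊆ (O : Set K) ∧
    Subfield.closure ((k₁.map (algebraMap k K) : Set K) ∪ (S : Set K)) = E ∧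
    FGOver k₁ (⊤ : Subfield k) ∧
    ∀ t : K, t ∈ O → ∃ e : K, e ∈ E ∧ O.valuation (t - e) < 1

/-- SUB-RUNG `CoefficientFieldSwapLU_p`: rung 1 restricted to valuation rings admitting an inner coefficient field of finite
shape.  A literal special case of `DiscreteInseparableResidueLU` (`sub_rung_swap`). -/
def CoefficientFieldSwapLU (p : ℕ) : Prop :=
  ∀ (k K : Type) [Field k] [CharP k p] [Field K] [Algebra k K], (⊤ : IntermediateField k K).FG →
    ∀ O : ValuationSubring K, (∀ c : k, algebraMap k K c ∈ O) → IsDiscreteValuationRing O →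
      (∀ t : K, t ∈ O → ∃ (c : k) (n : ℕ), O.valuation (t ^ p ^ n - algebraMap k K c) < 1) →
      (∃ t : K, t ∈ O ∧ ∀ c : k, 1 ≤ O.valuation (t - algebraMap k K c)) →
      HasInnerCoefficientField k K O →
        RelLocalUniformization k K O

/-- The swap sub-rung IS a special case of rung 1 (pure logic). -/
theorem sub_rung_swap {p : ℕ} (h : DiscreteInseparableResidueLU p) : CoefficientFieldSwapLU p :=
  fun k K _ _ _ _ hfg O h0 hO h1 h2 _ => h k K hfg O h0 hO h1 h2

/-- NAMED FACT (to vendor, S) — **Knaf–Kuhlmann 2009, Thm. 1.5, first bullet** ("Let `(F|K,P)` be a valued function field with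
the property that `(F,P)` lies in the completion of a subfunction field `(F₀,P|_{F₀})` such that `P|_{F₀}` is an Abhyankar place
of `F₀|K`, `vF₀/vK` is torsion-free and `F₀P|KP` is separable.  If `P|_K = id_K`, then `P` is strongly smoothly
`K`-uniformizable"; p. 5: "`(F,P)` lies in the completion of `(F₀,P|_{F₀})` if for every `a ∈ F` and `α ∈ vF` there is some
`b ∈ F₀` such that `v(a-b) ≥ α`").  Rendered in the ambient framework of `Literature/…/ValuedFunctionFields.lean` exactly as
the tree renders KK 2005 Thm. 1.1 (`KnafKuhlmann2005_Thm11`): "`F₀P|KP` separable" (a finitely generated extension, `P|_{F₀}`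
being Abhyankar) = `SeparablyGeneratedOver`; "strongly smoothly" weakened to "smoothly" (`IsSmoothlyUniformizableIn`).
[cite: KnafKuhlmann2009 = arXiv:math/0702856, Thm. 1.5 (p. 5)] -/
def KnafKuhlmann2009_Thm15 : Prop :=
  ∀ (Ω : Type) [Field Ω] (V : ValuationSubring Ω) (K F₀ F : Subfield Ω),
    K ≤ F₀ → F₀ ≤ F → FGOver K F₀ → FGOver K F → (K : Set Ω) ⊆ (V : Set Ω) →
    IsAbhyankarPlace V K F₀ →
    (∀ a ∈ F₀, a ≠ 0 → ∀ n : ℕ, n ≠ 0 → (∃ b ∈ K, V.valuation (a ^ n) = V.valuation b) →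
        ∃ b ∈ K, V.valuation a = V.valuation b) →
    SeparablyGeneratedOver (resField V K) (resField V F₀) →
    (∀ a ∈ F, ∀ d ∈ F, d ≠ 0 → ∃ b ∈ F₀, V.valuation (a - b) ≤ V.valuation d) →
    ∀ Z : Finset Ω, (∀ z ∈ Z, z ∈ V ∧ z ∈ F) → IsSmoothlyUniformizableIn K V F (Z : Set Ω)

/-- STUB T2 `SwapDensity` (M, elementary valuation theory): for a DISCRETE `O` and a subfield `E ⊆ O` whose residues exhaust
the residue field, with `K/E` finitely generated, the subfunction field `F₀ := E(x)` (`x` a uniformizer) is Abhyankar over `E`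
(`ρ = 1`, `τ = 0`), `vF₀/vE = ℤ/0` is torsion-free, `F₀P = EP` (separably generated by `∅`), and `K` lies in the completion of
`F₀` (expand `a·x^{-N} ∈ O` digit by digit: `a ≡ Σ_{i<M} eᵢ xⁱ (mod x^M)` with `eᵢ ∈ E`). -/
def SwapDensity : Prop :=
  ∀ (K : Type) [Field K] (O : ValuationSubring K), IsDiscreteValuationRing O →
    ∀ E : Subfield K, (E : Set K) ⊆ (O : Set K) → FGOver E (⊤ : Subfield K) →
      (∀ t : K, t ∈ O → ∃ e : K, e ∈ E ∧ O.valuation (t - e) < 1) →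
      ∃ F₀ : Subfield K, E ≤ F₀ ∧ FGOver E F₀ ∧ IsAbhyankarPlace O E F₀ ∧
        (∀ a ∈ F₀, a ≠ 0 → ∀ n : ℕ, n ≠ 0 → (∃ b ∈ E, O.valuation (a ^ n) = O.valuation b) →
          ∃ b ∈ E, O.valuation a = O.valuation b) ∧
        SeparablyGeneratedOver (resField O E) (resField O F₀) ∧
        (∀ a ∈ (⊤ : Subfield K), ∀ d ∈ (⊤ : Subfield K), d ≠ 0 →
          ∃ b ∈ F₀, O.valuation (a - b) ≤ O.valuation d)

/-- STUB T1 `CoefficientFieldTransfer` (M, commutative algebra): `k ⊆ O`, `K/k` finitely generated, an inner coefficient field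
`E = k₁(S)` of finite shape (`k/k₁` finitely generated).  IF `K` is smoothly `E`-uniformizable at `O` for every finite `Z ⊆ O`
(granted that `K/E` is finitely generated — which T1 itself proves: `K = E(k-generators over k₁, K-generators over k)`), THEN
`RelLocalUniformization k K O`.  Proof: given `R = k[r] ⊆ O`, take `Z = {r} ∪ {generators of k over k₁} ∪ S`, get
`A ⊆ O` smooth over the field `E` at the centre `𝔭` (hence `A_𝔭` regular) with `Z ⊆ A_𝔭`; put `A₀ := k[Z, gens A] ⊆ O`:
non-zero elements of `k₁[gens of k]` and of `k₁[S]` are units of `O` lying in `A_𝔭` resp. `(A₀)_𝔮`, so `k ⊆ A_𝔭`, `E ⊆ (A₀)_𝔮`,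
and `(A₀)_𝔮 = A_𝔭` inside `K`; `R ≤ A₀`, `Frac A₀ = K`. -/
def CoefficientFieldTransfer : Prop :=
  ∀ (k K : Type) [Field k] [Field K] [Algebra k K], (⊤ : IntermediateField k K).FG →
    ∀ O : ValuationSubring K, (∀ c : k, algebraMap k K c ∈ O) →
    ∀ (E : Subfield K) (k₁ : Subfield k) (S : Finset K), (E : Set K) ⊆ (O : Set K) →
      Subfield.closure ((k₁.map (algebraMap k K) : Set K) ∪ (S : Set K)) = E →
      FGOver k₁ (⊤ : Subfield k) →
      (FGOver E (⊤ : Subfield K) →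
          ∀ Z : Finset K, (∀ z ∈ Z, z ∈ O) → IsSmoothlyUniformizableIn E O (⊤ : Subfield K) (Z : Set K)) →
        RelLocalUniformization k K O

/-- ASSEMBLY 1 (kernel-checked, no sorry): KK 2009 Thm. 1.5 + T2 + T1 give the swap sub-rung. -/
theorem CoefficientFieldSwapLU_of {p : ℕ} (hKK : KnafKuhlmann2009_Thm15) (hT2 : SwapDensity)
    (hT1 : CoefficientFieldTransfer) : CoefficientFieldSwapLU p := by
  intro k K _ _ _ _ hfg O hk hO _hres _hne hCS
  obtain ⟨E, k₁, S, hEO, hE, hk₁, hres⟩ := hCS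
  refine hT1 k K hfg O hk E k₁ S hEO hE hk₁ ?_
  intro hFG Z hZ
  obtain ⟨F₀, hEF₀, hfg₀, hAbh, htf, hsep, hdense⟩ := hT2 K O hO E hEO hFG hres
  exact hKK K O E F₀ ⊤ hEF₀ le_top hfg₀ hFG hEO hAbh htf hsep hdense Z
    (fun z hz => ⟨hZ z hz, Subfield.mem_top z⟩)

/-- SUB-RUNG WITH TEETH `FreeRadicandSimpleResidueLU_p`: rung 1 for a SIMPLE residue field `κ = k̄(t̄₀)` of ANY exponent
(`v(t₀^{p^n} - c) > 0`, every residue a `k`-polynomial in `t̄₀`) whose radicand `c` is FREE in `k` (`k = k₁(c)`, `c` transcendental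
over `k₁`).  NO type-D/E/F clause: ramified (E) and residue-defect (F) steps are covered alike.  A literal special case of rung 1
(`sub_rung_free`); incomparable with `ArcSlice.DiscreteTypeDSimpleResidueLU` (that one has no freeness, this one no type). -/
def FreeRadicandSimpleResidueLU (p : ℕ) : Prop :=
  ∀ (k K : Type) [Field k] [CharP k p] [Field K] [Algebra k K], (⊤ : IntermediateField k K).FG →
    ∀ O : ValuationSubring K, (∀ c : k, algebraMap k K c ∈ O) → IsDiscreteValuationRing O →
      (∀ t : K, t ∈ O → ∃ (c : k) (n : ℕ), O.valuation (t ^ p ^ n - algebraMap k K c) < 1) →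
      (∃ t : K, t ∈ O ∧ ∀ c : k, 1 ≤ O.valuation (t - algebraMap k K c)) →
      (∃ (t₀ : K) (c : k) (n : ℕ), t₀ ∈ O ∧ O.valuation (t₀ ^ p ^ n - algebraMap k K c) < 1 ∧
          (∀ t : K, t ∈ O → ∃ q : Polynomial k, O.valuation (t - Polynomial.aeval t₀ q) < 1) ∧
          ∃ k₁ : Subfield k, Transcendental k₁ c ∧ Subfield.closure ((k₁ : Set k) ∪ {c}) = ⊤) →
        RelLocalUniformization k K O

/-- The free-radicand sub-rung IS a special case of rung 1 (pure logic). -/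
theorem sub_rung_free {p : ℕ} (h : DiscreteInseparableResidueLU p) : FreeRadicandSimpleResidueLU p :=
  fun k K _ _ _ _ hfg O h0 hO h1 h2 _ => h k K hfg O h0 hO h1 h2

/-- STUB T3 `FreeRadicandLift_p` (M, Mathlib field theory): with `κ = k̄(t̄₀)`, `t̄₀^{p^n} = c̄`, `k = k₁(c)`, `c` transcendental over
`k₁`: `E := k₁(t₀) ⊆ K` lies in `O` (a non-zero `Q(t₀)`, `Q ∈ k₁[X]`, is a unit because `t̄₀` is transcendental over `k̄₁`, as
`t̄₀^{p^n} = c̄` is), its residues exhaust `κ` (write a residue `q(t̄₀)`, `q ∈ k[X] = k₁(c)[X]`, and substitute `c ↦ t₀^{p^n}`),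
and `k = k₁(c)` is finitely generated over `k₁`: the inner coefficient field of finite shape `(E, k₁, {t₀})`. -/
def FreeRadicandLift (p : ℕ) : Prop :=
  ∀ (k K : Type) [Field k] [CharP k p] [Field K] [Algebra k K],
    ∀ O : ValuationSubring K, (∀ c : k, algebraMap k K c ∈ O) →
    ∀ (t₀ : K) (c : k) (n : ℕ), t₀ ∈ O → O.valuation (t₀ ^ p ^ n - algebraMap k K c) < 1 →
      (∀ t : K, t ∈ O → ∃ q : Polynomial k, O.valuation (t - Polynomial.aeval t₀ q) < 1) →
      ∀ k₁ : Subfield k, Transcendental k₁ c → Subfield.closure ((k₁ : Set k) ∪ {c}) = ⊤ →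
        HasInnerCoefficientField k K O

/-- ASSEMBLY 2 (kernel-checked, no sorry): the swap sub-rung + T3 give the free-radicand sub-rung. -/
theorem FreeRadicandSimpleResidueLU_of {p : ℕ} (hS : CoefficientFieldSwapLU p) (hL : FreeRadicandLift p) :
    FreeRadicandSimpleResidueLU p := by
  intro k K _ _ _ _ hfg O hk hO hres hne hdat
  obtain ⟨t₀, c, n, ht₀, hc, hpoly, k₁, htr, hgen⟩ := hdat
  exact hS k K hfg O hk hO hres hne (hL k K O hk t₀ c n ht₀ hc hpoly k₁ htr hgen)

/-- END-TO-END (kernel-checked, no sorry): fact + three M-stubs ⇒ the free-radicand sub-rung. -/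
theorem FreeRadicandSimpleResidueLU_of_stubs {p : ℕ} (hKK : KnafKuhlmann2009_Thm15) (hT2 : SwapDensity)
    (hT1 : CoefficientFieldTransfer) (hL : FreeRadicandLift p) : FreeRadicandSimpleResidueLU p :=
  FreeRadicandSimpleResidueLU_of (CoefficientFieldSwapLU_of hKK hT2 hT1) hL

end Summit.ResolutionOfSingularities.ResolutionOfSingularities.Cruxes.DescentPerfectToAll.ConstantSwap

end
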